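import Summits.ValiantsHypothesis.ValiantsHypothesis.Theorems.GrenetZeonDualUnipotentThreeHalvesSlowCoreLedger

/-!
# MONOMIAL LEDGER — coordinate-span certificates of (c) `LongMassSlowLawInv` are read off the monomial SUPPORT of the powers
# (val-idea-27 g9, lens (b) «representation-theoretic / weight argument»; crux `GrenetZeon.DualUnipotentThreeHalves` = stmt-ValiantsHypothesis-24318)

Status.  VP ≠ VNP NOT proved.  (c) `SlowCore.LongMassSlowLawInv` (the one research stub of `Lines/slow_core.lean` rev 4) / S3 / R2ᵖ / 24318 OPEN.
This file asserts no law: it is a sorry-free EXACT DICTIONARY (both directions) for the ledgers whose direction space is a COORDINATE SPAN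
`K_T = span{δ_e : e ∈ T}` — the only direction spaces that matter in the torus-fixed corners (α)/(β) of the (c)-enemy hunt, by val-idea-28's
★ `InitialForm.LedgerTorus.relCert_iff_coordinate_span` (torus-equivariant pencil, injective coordinate weights ⇒ `RelCert` is attained on a
coordinate span).

THE DICTIONARY (§3, `ledger_coordSpan_iff_suppWindow`).  For EVERY pencil `N : AffMat n m` (no affinity, no torus, no nilpotency needed), every
coordinate set `T` and every window `k`:
    `Ledger n m N ⊤ (coordSpan T) k  ↔  ∀ p ≤ n − 1, ∀ i j, every monomial x^d in the support of the entry (N^p) i j has T-content Σ_{e ∈ T} d e ≤ k`.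
So a coordinate-span certificate is a property of the monomial SUPPORT of the first `n − 1` powers of the symbolic pencil — no base point `x`, no
direction `v`, no line parameter `s`.  (⇐) is one line (along `v` supported on `T` only the `T`-variables move); (⇒) is a genericity argument: substitute
`x := z` off `T`, `x := 0` on `T`, `v := z` on `T` — then `x^d ↦ z^d · s^{T-content(d)}`, so the top `s`-coefficient of the substituted entry is the
value at `z` of the top T-weighted component of the entry, which is a non-zero polynomial and therefore has a non-root (`MvPolynomial.funext`, ℂ infinite).

CONSEQUENCES (rows for the (c)-seat / the census cell; nothing here is progress on (c)).
(1) CERTIFY (`relCert_of_suppWindow`): price `n·k + (n² − #T)` from ONE support inspection — the «MONOMIAL KNAPSACK»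
    `price_mono(N) := min_{T,k : SuppWindow N T k} n·k + (n² − #T)` is an upper bound for the price of every pencil, and in corners (α)/(β) it IS the
    price (by name with val-idea-28's `relCert_iff_coordinate_span`; the two `span` expressions are syntactically identical).
(2) REFUTE (`tdeg_le_of_ledger_coordSpan`): a coordinate-span ledger `(K_T, k)` is killed by ONE monomial of T-content `> k` in ONE entry of ONE power
    `p ≤ n − 1`.  This is the JOINT form of the per-coordinate census ★ `not_relCert_of_count` (whose tameness test `WindowCone N k (δ_e)` is, by the
    dictionary with `T = {e}`, «`degreeOf e ≤ k` in all powers `≤ n − 1`»): `T ⊆ {k-tame coordinates}` is necessary but far from sufficient —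
    calibration: in the Sidon-pattern model of `𝔫_b` every position is `1`-tame (a path uses a position once), so the count census certifies no lower
    bound above price `n`, while the knapsack value is Lemma P's `≈ 2.65·√n·b` (crit-7 V35); the two differ by the factor `b/√n` that defines the live box.
(3) CORNER (β) (one coordinate per weight class, crit-7 V35 §3): the monomials of `(N^p) i j` are the CLASS MULTISETS `m` whose SYMMETRISED class-word
    sum `𝒩_m := Σ_{orderings} D_{γ_1}⋯D_{γ_p}` has a non-zero `(i,j)` entry («live multisets»); so (c)|(β) reads: for every strongly connected graded nil
    species there is a class set `F` (frozen) with `#F + n·max{ |m| − m(F) : m live, |m| ≤ n − 1 } ≤ c√n·b`.  Cancellation enters ONLY through EARLY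
    DEATHS (`𝒩_m = 0` although a walk with class multiset `m` exists); at walk level (no early deaths used) the optimum is a max-cycle-mean problem,
    i.e. (Karp duality) a real-valued LEVEL-FUNCTION banding — the family of rows r1 / r7 / `BandDepth` / `ratioBound_of_profile`.  See the memo
    `MEMO-idea27-g9-weight-lens.md` for the statement and what it does and does not buy.
§5 states the corner consequences in HYPOTHESIS form (idea-28's coordinate-span reduction as `hred`), so this file needs no import beyond `SlowCoreLedger`.
Honest limits: instrument only; the knapsack is exact for coordinate spans and an upper bound in general (corner (γ) and non-graded pencils need
general `K`); VP ≠ VNP NOT proved; (c) OPEN.  [rev 2: + §5]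
-/

-- single-conjunct layout: Sub = Summit, duplicated namespace component intended (the name is mandated)
set_option linter.dupNamespace false
set_option autoImplicit false

noncomputable section

namespace Summit.ValiantsHypothesis.ValiantsHypothesis.Cruxes.DualUnipotentThreeHalves.MonomialLedger

open MvPolynomial Matrix
open scoped BigOperators
open Summit.ValiantsHypothesis.ValiantsHypothesis.Cruxes.TwoDimCoefficients.DimTwoCases (AffMat IsAffine)
open Summit.ValiantsHypothesis.ValiantsHypothesis.Theorems.GrenetZeon.RadicalSplit (lineSubst)
open Summit.ValiantsHypothesis.ValiantsHypothesis.Theorems.GrenetZeon.SlowCore (Ledger RelCert)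

variable {n m : ℕ}

/-! ## §1 T-content of a monomial, the support window, coordinate spans -/

/-- The `T`-CONTENT of an exponent vector `d`: `Σ_{e ∈ T} d e` (the weighted degree for the indicator weight of `T`). -/
def tdeg {σ : Type*} (T : Finset σ) (d : σ →₀ ℕ) : ℕ := ∑ e ∈ T, d e

/-- **SUPPORT WINDOW**: every monomial of every entry of every power `p ≤ n − 1` of the symbolic pencil has `T`-content `≤ k`. -/
def SuppWindow (N : AffMat n m) (T : Finset (Fin n × Fin n)) (k : ℕ) : Prop :=
  ∀ p : ℕ, p ≤ n - 1 → ∀ i j : Fin m, ∀ d ∈ ((N ^ p) i j).support, tdeg T d ≤ k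

/-- The COORDINATE SPAN of `T` (syntactically the `span` of val-idea-28's `relCert_iff_coordinate_span`). -/
def coordSpan (T : Finset (Fin n × Fin n)) : Submodule ℂ (Fin n × Fin n → ℂ) :=
  Submodule.span ℂ (Set.range fun e : T => (Pi.single (e : Fin n × Fin n) (1 : ℂ) : Fin n × Fin n → ℂ))

theorem tdeg_eq_sum_support {σ : Type*} [DecidableEq σ] (T : Finset σ) (d : σ →₀ ℕ) :
    tdeg T d = ∑ e ∈ d.support, if e ∈ T then d e else 0 := by
  classical
  rw [Finset.sum_ite_mem, tdeg, Finset.inter_comm]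
  symm
  apply Finset.sum_subset (Finset.inter_subset_left)
  intro e heT hnot
  have : e ∉ d.support := fun h => hnot (Finset.mem_inter.mpr ⟨heT, h⟩)
  simpa [Finsupp.mem_support_iff] using this

theorem tdeg_le_degree {σ : Type*} [DecidableEq σ] (T : Finset σ) (d : σ →₀ ℕ) :
    tdeg T d ≤ ∑ e ∈ d.support, d e := by
  rw [tdeg_eq_sum_support]
  exact Finset.sum_le_sum fun e _ => by split_ifs <;> simp

/-- Members of the coordinate span vanish off `T`. -/
theorem apply_eq_zero_of_mem_coordSpan {T : Finset (Fin n × Fin n)} {v : Fin n × Fin n → ℂ} (hv : v ∈ coordSpan T)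
    {e : Fin n × Fin n} (he : e ∉ T) : v e = 0 := by
  induction hv using Submodule.span_induction with
  | mem x hx =>
      obtain ⟨⟨e', he'⟩, rfl⟩ := hx
      have : (e' : Fin n × Fin n) ≠ e := fun h => he (h ▸ he')
      simp [Ne.symm this]
  | zero => rfl
  | add x y _ _ hx hy => simp [hx, hy]
  | smul a x _ hx => simp [hx]

/-- Functions supported on `T` lie in the coordinate span. -/
theorem mem_coordSpan_of_support {T : Finset (Fin n × Fin n)} {v : Fin n × Fin n → ℂ} (hv : ∀ e, e ∉ T → v e = 0) :
    v ∈ coordSpan T := by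
  classical
  have hrepr : v = ∑ e ∈ T.attach, v (e : Fin n × Fin n) • (Pi.single (e : Fin n × Fin n) (1 : ℂ) : Fin n × Fin n → ℂ) := by
    funext e'
    simp only [Finset.sum_apply, Pi.smul_apply, Pi.single_apply, smul_eq_mul, mul_ite, mul_one, mul_zero]
    by_cases he' : e' ∈ T
    · rw [Finset.sum_eq_single ⟨e', he'⟩]
      · simp
      · intro b _ hb
        have : (e' : Fin n × Fin n) ≠ b := fun h => hb (Subtype.ext h.symm)
        simp [this]
      · intro h; exact absurd (Finset.mem_attach _ _) h
    · rw [hv e' he']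
      symm
      apply Finset.sum_eq_zero
      intro b _
      have : (e' : Fin n × Fin n) ≠ b := fun h => he' (h ▸ b.2)
      simp [this]
  rw [hrepr]
  refine Submodule.sum_mem _ fun e _ => Submodule.smul_mem _ _ (Submodule.subset_span ⟨e, rfl⟩)
  
theorem mem_coordSpan_iff {T : Finset (Fin n × Fin n)} {v : Fin n × Fin n → ℂ} :
    v ∈ coordSpan T ↔ ∀ e, e ∉ T → v e = 0 :=
  ⟨fun hv _ he => apply_eq_zero_of_mem_coordSpan hv he, mem_coordSpan_of_support⟩

/-- `dim coordSpan T = #T`. -/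
theorem finrank_coordSpan (T : Finset (Fin n × Fin n)) : Module.finrank ℂ (coordSpan T) = T.card := by
  classical
  have hli : LinearIndependent ℂ fun e : T => (Pi.single (e : Fin n × Fin n) (1 : ℂ) : Fin n × Fin n → ℂ) := by
    have h0 : LinearIndependent ℂ fun e : Fin n × Fin n => (Pi.single e (1 : ℂ) : Fin n × Fin n → ℂ) :=
      Pi.linearIndependent_single_one (Fin n × Fin n) ℂ
    exact h0.comp (fun e : T => (e : Fin n × Fin n)) Subtype.val_injective
  rw [coordSpan, finrank_span_eq_card hli, Fintype.card_coe]

/-! ## §2 Substitution of a monomial along a line -/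

/-- `lineSubst x v (c·x^d) = c · ∏_{e ∈ supp d} (x_e + v_e s)^{d_e}`. -/
theorem lineSubst_monomial {σ : Type*} (x v : σ → ℂ) (d : σ →₀ ℕ) (c : ℂ) :
    lineSubst x v (monomial d c) = C c * ∏ e ∈ d.support, (C (x e) + C (v e) * X 0) ^ (d e) := by
  rw [lineSubst, aeval_monomial, MvPolynomial.algebraMap_eq]
  congr 1
  simp [Finsupp.prod]

/-- (⇐, per monomial) along a direction vanishing off `T`, the substituted monomial has `s`-degree `≤` its `T`-content. -/
theorem totalDegree_lineSubst_monomial_le {σ : Type*} [DecidableEq σ] (T : Finset σ) (x v : σ → ℂ) (hv : ∀ e, e ∉ T → v e = 0)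
    (d : σ →₀ ℕ) (c : ℂ) : (lineSubst x v (monomial d c)).totalDegree ≤ tdeg T d := by
  rw [lineSubst_monomial, tdeg_eq_sum_support]
  refine (totalDegree_mul _ _).trans ?_
  rw [totalDegree_C, zero_add]
  refine (totalDegree_finsetProd _ _).trans (Finset.sum_le_sum fun e _ => ?_)
  refine (totalDegree_pow _ _).trans ?_
  by_cases he : e ∈ T
  · rw [if_pos he]
    have h1 : (C (x e) + C (v e) * X (0 : Fin 1) : MvPolynomial (Fin 1) ℂ).totalDegree ≤ 1 := by
      refine (totalDegree_add _ _).trans (max_le ?_ ?_)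
      · rw [totalDegree_C]; exact Nat.zero_le _
      · refine (totalDegree_mul _ _).trans ?_
        rw [totalDegree_C, totalDegree_X, zero_add]
    calc d e * (C (x e) + C (v e) * X (0 : Fin 1) : MvPolynomial (Fin 1) ℂ).totalDegree ≤ d e * 1 :=
          Nat.mul_le_mul_left _ h1
      _ = d e := mul_one _
  · rw [if_neg he, hv e he]
    simp [totalDegree_C]

/-- (⇒, per monomial) the SPLIT substitution `x := z` off `T`, `x := 0` on `T`, `v := z` on `T`, `v := 0` off `T` sends `c·x^d` to the single
`s`-monomial `eval z (c·x^d) · s^{T-content(d)}`. -/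
theorem lineSubst_split_monomial {σ : Type*} [DecidableEq σ] (T : Finset σ) (z : σ → ℂ) (d : σ →₀ ℕ) (c : ℂ) :
    lineSubst (fun e => if e ∈ T then 0 else z e) (fun e => if e ∈ T then z e else 0) (monomial d c)
      = C (eval z (monomial d c)) * X 0 ^ (tdeg T d) := by
  rw [lineSubst_monomial, eval_monomial, tdeg_eq_sum_support]
  have hfac : ∀ e ∈ d.support,
      (C (if e ∈ T then (0 : ℂ) else z e) + C (if e ∈ T then z e else 0) * X (0 : Fin 1) : MvPolynomial (Fin 1) ℂ) ^ (d e)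
        = C (z e ^ d e) * X 0 ^ (if e ∈ T then d e else 0) := by
    intro e _
    by_cases he : e ∈ T
    · simp only [if_pos he, C_0, zero_add, mul_pow, C_pow]
    · simp only [if_neg he, C_0, zero_mul, add_zero, C_pow, pow_zero, mul_one]
  rw [Finset.prod_congr rfl hfac, Finset.prod_mul_distrib, Finset.prod_pow_eq_pow_sum, ← map_prod C, ← mul_assoc, ← C_mul]
  simp [Finsupp.prod]

/-! ## §3 THE DICTIONARY -/

/-- ★ (⇐) **a support window is a coordinate-span ledger.** -/
theorem ledger_coordSpan_of_suppWindow (N : AffMat n m) (T : Finset (Fin n × Fin n)) (k : ℕ) (h : SuppWindow N T k) :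
    Ledger n m N (fun _ => True) (coordSpan T) k := by
  classical
  intro x v hv p hp i j _ _
  have hmap : (N.map (lineSubst x v)) ^ p = (N ^ p).map (lineSubst x v) := by
    have := Matrix.map_pow N ((lineSubst x v : MvPolynomial (Fin n × Fin n) ℂ →ₐ[ℂ] MvPolynomial (Fin 1) ℂ) :
      MvPolynomial (Fin n × Fin n) ℂ →+* MvPolynomial (Fin 1) ℂ) p
    simpa using this.symm
  rw [hmap, Matrix.map_apply]
  set f := (N ^ p) i j with hf
  have hv' : ∀ e, e ∉ T → v e = 0 := fun e he => apply_eq_zero_of_mem_coordSpan hv he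
  conv_lhs => rw [f.as_sum]
  rw [map_sum]
  refine (totalDegree_finsetSum _ _).trans (Finset.sup_le fun d hd => ?_)
  exact (totalDegree_lineSubst_monomial_le T x v hv' d _).trans (h p hp i j d hd)

/-- ★ (⇒) **a coordinate-span ledger bounds the T-content of every monomial of every power `≤ n − 1`.** -/
theorem tdeg_le_of_ledger_coordSpan (N : AffMat n m) (T : Finset (Fin n × Fin n)) (k : ℕ)
    (h : Ledger n m N (fun _ => True) (coordSpan T) k) {p : ℕ} (hp : p ≤ n - 1) (i j : Fin m)
    {d : (Fin n × Fin n) →₀ ℕ} (hd : d ∈ ((N ^ p) i j).support) : tdeg T d ≤ k := by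
  classical
  by_contra hlt
  push Not at hlt
  set f := (N ^ p) i j with hf
  -- the top T-content `D` and the top component `g`
  have hne : f.support.Nonempty := ⟨d, hd⟩
  obtain ⟨d₁, hd₁, hD⟩ := Finset.exists_mem_eq_sup f.support hne (tdeg T)
  set D := f.support.sup (tdeg T) with hDdef
  have hdD : tdeg T d ≤ D := Finset.le_sup hd
  have hkD : k < D := lt_of_lt_of_le hlt hdD
  set g : MvPolynomial (Fin n × Fin n) ℂ := ∑ d' ∈ f.support.filter (fun d' => tdeg T d' = D), monomial d' (coeff d' f) with hg
  have hg_ne : g ≠ 0 := by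
    intro h0
    have hc : coeff d₁ g = coeff d₁ f := by
      rw [hg, coeff_sum]
      simp only [coeff_monomial]
      rw [Finset.sum_ite_eq' (f.support.filter fun d' => tdeg T d' = D) d₁ (fun d' => coeff d' f)]
      rw [if_pos (Finset.mem_filter.mpr ⟨hd₁, hD.symm⟩)]
    have : coeff d₁ f = 0 := by rw [← hc, h0, coeff_zero]
    exact (mem_support_iff.mp hd₁) this
  -- a non-root of `g`
  have hz : ∃ z : Fin n × Fin n → ℂ, eval z g ≠ 0 := by
    by_contra hall
    push Not at hall
    exact hg_ne (MvPolynomial.funext fun z => by rw [hall z, map_zero])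
  obtain ⟨z, hz⟩ := hz
  -- the split substitution
  set x₀ : Fin n × Fin n → ℂ := fun e => if e ∈ T then 0 else z e with hx₀
  set v₀ : Fin n × Fin n → ℂ := fun e => if e ∈ T then z e else 0 with hv₀
  have hv₀mem : v₀ ∈ coordSpan T := mem_coordSpan_of_support fun e he => by simp [hv₀, he]
  -- KEY: the `s^D`-coefficient of the substituted entry is `eval z g`
  have hkey : coeff (Finsupp.single 0 D) (lineSubst x₀ v₀ f) = eval z g := by
    conv_lhs => rw [f.as_sum]
    rw [map_sum, coeff_sum]
    have hterm : ∀ d' ∈ f.support, coeff (Finsupp.single 0 D) (lineSubst x₀ v₀ (monomial d' (coeff d' f)))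
        = if tdeg T d' = D then eval z (monomial d' (coeff d' f)) else 0 := by
      intro d' _
      rw [hx₀, hv₀, lineSubst_split_monomial T z d' (coeff d' f), coeff_C_mul, coeff_X_pow]
      by_cases hdeg : tdeg T d' = D
      · rw [if_pos (by rw [hdeg]), if_pos hdeg, mul_one]
      · rw [if_neg (fun h => hdeg (Finsupp.single_injective (0 : Fin 1) h)), if_neg hdeg, mul_zero]
    rw [Finset.sum_congr rfl hterm, ← Finset.sum_filter, hg, map_sum]
  -- but the ledger says the substituted entry has `s`-degree `≤ k < D`
  have hdegle : (lineSubst x₀ v₀ f).totalDegree ≤ k := by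
    have := h x₀ v₀ hv₀mem p hp i j trivial trivial
    have hmap : (N.map (lineSubst x₀ v₀)) ^ p = (N ^ p).map (lineSubst x₀ v₀) := by
      have := Matrix.map_pow N ((lineSubst x₀ v₀ : MvPolynomial (Fin n × Fin n) ℂ →ₐ[ℂ] MvPolynomial (Fin 1) ℂ) :
        MvPolynomial (Fin n × Fin n) ℂ →+* MvPolynomial (Fin 1) ℂ) p
      simpa using this.symm
    rwa [hmap, Matrix.map_apply] at this
  have hcoeff0 : coeff (Finsupp.single 0 D) (lineSubst x₀ v₀ f) = 0 := by
    apply coeff_eq_zero_of_totalDegree_lt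
    have hD0 : D ≠ 0 := by omega
    rw [Finsupp.support_single _ hD0, Finset.sum_singleton, Finsupp.single_eq_same]
    exact lt_of_le_of_lt hdegle hkD
  exact hz (hkey ▸ hcoeff0)

/-- ★★ **THE DICTIONARY**: coordinate-span ledger `↔` support window. -/
theorem ledger_coordSpan_iff_suppWindow (N : AffMat n m) (T : Finset (Fin n × Fin n)) (k : ℕ) :
    Ledger n m N (fun _ => True) (coordSpan T) k ↔ SuppWindow N T k :=
  ⟨fun h _ hp i j _ hd => tdeg_le_of_ledger_coordSpan N T k h hp i j hd, ledger_coordSpan_of_suppWindow N T k⟩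

/-! ## §4 Price consequences -/

/-- ★ **CERTIFY BY SUPPORT** (the monomial knapsack is an upper bound for the price of every pencil). -/
theorem relCert_of_suppWindow (N : AffMat n m) (T : Finset (Fin n × Fin n)) (k P : ℕ) (h : SuppWindow N T k)
    (hP : n * k + (n * n - T.card) ≤ P) : RelCert n m N P :=
  ⟨coordSpan T, k, ledger_coordSpan_of_suppWindow N T k h, by rwa [finrank_coordSpan]⟩

/-- ★ **REFUTE BY ONE MONOMIAL**: a monomial of `T`-content `> k` in some entry of some power `p ≤ n − 1` kills the coordinate-span ledger `(K_T, k)`. -/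
theorem not_ledger_coordSpan_of_monomial (N : AffMat n m) (T : Finset (Fin n × Fin n)) (k : ℕ) {p : ℕ} (hp : p ≤ n - 1) (i j : Fin m)
    {d : (Fin n × Fin n) →₀ ℕ} (hd : d ∈ ((N ^ p) i j).support) (hk : k < tdeg T d) :
    ¬ Ledger n m N (fun _ => True) (coordSpan T) k :=
  fun h => absurd (tdeg_le_of_ledger_coordSpan N T k h hp i j hd) (not_le.mpr hk)

/-- The single-coordinate instance: `(K_{{e}}, k)` is a ledger iff `e` occurs with exponent `≤ k` in every monomial of every power `≤ n − 1`
(this is the tameness test of the per-coordinate census, now as a support statement). -/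
theorem ledger_single_iff (N : AffMat n m) (e : Fin n × Fin n) (k : ℕ) :
    Ledger n m N (fun _ => True) (coordSpan {e}) k ↔
      ∀ p : ℕ, p ≤ n - 1 → ∀ i j : Fin m, ∀ d ∈ ((N ^ p) i j).support, d e ≤ k := by
  rw [ledger_coordSpan_iff_suppWindow]
  simp [SuppWindow, tdeg]

/-- **JOINT vs PER-COORDINATE**: a support window on `T` makes every `e ∈ T` tame (the converse fails — the census undercounts). -/
theorem single_tame_of_suppWindow (N : AffMat n m) (T : Finset (Fin n × Fin n)) (k : ℕ) (h : SuppWindow N T k)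
    {e : Fin n × Fin n} (he : e ∈ T) : SuppWindow N {e} k := by
  classical
  intro p hp i j d hd
  have := h p hp i j d hd
  rw [tdeg, Finset.sum_singleton]
  exact le_trans (Finset.single_le_sum (f := fun e => d e) (fun _ _ => Nat.zero_le _) he) this

/-! ## §5 The torus corners (α)/(β), in HYPOTHESIS form

Compose with val-idea-28 ★ `InitialForm.LedgerTorus.relCert_iff_coordinate_span N w hT hw` (torus-equivariant pencil, injective coordinate weights),
whose conclusion is literally `hred` below; the companion `MonomialLedgerCensus.lean` does the composition by name once the farm has both modules built. -/

/-- ★★ **EXACT PRICE = MONOMIAL KNAPSACK** (hypothesis form): if `RelCert` is attained on coordinate spans (idea-28's reduction), then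
`RelCert n m N P` iff some `(T, k)` with `n·k + (n² − #T) ≤ P` is a support window — a finite invariant of `supp N, supp N², …, supp N^{n−1}`. -/
theorem relCert_iff_suppWindow_of_reduction (N : AffMat n m)
    (hred : ∀ P : ℕ, RelCert n m N P ↔ ∃ (k : ℕ) (T : Finset (Fin n × Fin n)), n * k + (n * n - T.card) ≤ P ∧
      Ledger n m N (fun _ => True)
        (Submodule.span ℂ (Set.range fun e : T => (Pi.single (e : Fin n × Fin n) (1 : ℂ) : Fin n × Fin n → ℂ))) k)
    (P : ℕ) :
    RelCert n m N P ↔ ∃ (k : ℕ) (T : Finset (Fin n × Fin n)), n * k + (n * n - T.card) ≤ P ∧ SuppWindow N T k := by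
  rw [hred P]
  exact exists_congr fun k => exists_congr fun T => and_congr Iff.rfl (ledger_coordSpan_iff_suppWindow N T k)

/-- The refuter's form under the same reduction: `¬ RelCert n m N P` iff every affordable `(T, k)` is killed by ONE monomial of `T`-content `> k`
in one entry of one power `p ≤ n − 1`. -/
theorem not_relCert_iff_monomial_witness_of_reduction (N : AffMat n m)
    (hred : ∀ P : ℕ, RelCert n m N P ↔ ∃ (k : ℕ) (T : Finset (Fin n × Fin n)), n * k + (n * n - T.card) ≤ P ∧
      Ledger n m N (fun _ => True)
        (Submodule.span ℂ (Set.range fun e : T => (Pi.single (e : Fin n × Fin n) (1 : ℂ) : Fin n × Fin n → ℂ))) k)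
    (P : ℕ) :
    ¬ RelCert n m N P ↔ ∀ (k : ℕ) (T : Finset (Fin n × Fin n)), n * k + (n * n - T.card) ≤ P →
      ∃ p : ℕ, p ≤ n - 1 ∧ ∃ i j : Fin m, ∃ d ∈ ((N ^ p) i j).support, k < tdeg T d := by
  rw [relCert_iff_suppWindow_of_reduction N hred P]
  simp only [not_exists, not_and, SuppWindow, not_forall, not_le, exists_prop]

/-- A support window makes every coordinate direction `δ_e`, `e ∈ T`, pass the single-direction window test (the body of idea-28's
`WindowCone N k (Pi.single e 1)`, i.e. the tameness test counted by ★ `not_relCert_of_count`). -/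
theorem window_single_of_suppWindow (N : AffMat n m) (T : Finset (Fin n × Fin n)) (k : ℕ) (h : SuppWindow N T k)
    {e : Fin n × Fin n} (he : e ∈ T) (x : Fin n × Fin n → ℂ) {p : ℕ} (hp : p ≤ n - 1) (i j : Fin m) :
    ((((N.map (lineSubst x (Pi.single e (1 : ℂ)))) ^ p) i j)).totalDegree ≤ k :=
  ledger_coordSpan_of_suppWindow N T k h x _ (Submodule.subset_span ⟨⟨e, he⟩, rfl⟩) p hp i j trivial trivial

/-- ★ **THE COUNT CENSUS UNDERCOUNTS**: every knapsack-feasible `T` of order `k` lies inside the set of `k`-tame coordinates, so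
`#T ≤ count_k` and the census price bound `min_k n·k + (n² − count_k)` is at most the knapsack value (strictly smaller in general:
Sidon-pattern `𝔫_b`, every coordinate `1`-tame, knapsack `≈ 2.65·√n·b`). -/
theorem card_le_count_of_suppWindow (N : AffMat n m) (T : Finset (Fin n × Fin n)) (k : ℕ) (h : SuppWindow N T k) :
    T.card ≤ (open Classical in (Finset.univ.filter fun e : Fin n × Fin n =>
      ∀ x : Fin n × Fin n → ℂ, ∀ b : ℕ, b ≤ n - 1 → ∀ i j : Fin m,
        ((((N.map (lineSubst x (Pi.single e (1 : ℂ)))) ^ b) i j)).totalDegree ≤ k).card) := by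
  classical
  apply Finset.card_le_card
  intro e he
  exact Finset.mem_filter.mpr ⟨Finset.mem_univ _, fun x b hb i j => window_single_of_suppWindow N T k h he x hb i j⟩

end Summit.ValiantsHypothesis.ValiantsHypothesis.Cruxes.DualUnipotentThreeHalves.MonomialLedger

end
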